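import Summits.FinalStateConjecture.FinalStateConjecture.Theorems.ClusterCompletenessLinearToNonlinearCaptureTwoPinsLocalEnergy
import HarnessLib

/-!
# Crux `LinearToNonlinearCapture` (stmt-FinalStateConjecture-14526), line `two-pins-and-completeness` —
# stub `stub_scalarRateFreeDecay`, helper: local energy propagation, uniform in the base time

Helper file (`--supports stmt-FinalStateConjecture-14526`) for the registered stub
`stub_scalarRateFreeDecay : AdiabaticMultiKerrILED → ScalarRateFreeDecay` of the skeleton
`LinearToNonlinearCapture` (route `ClusterCompleteness`).

From the base-time-`0` estimate `srfd_localEnergyZero` (`…TwoPinsLocalEnergy.lean`) we derive the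
estimate uniform in the base time `s ≥ 0`: on the tails-cut patched multi-Kerr background `G` of a
`40`-separated, strictly receding configuration there is `K < ∞` (depending on the configuration
only) such that every smooth solution `ψ` of the divergence-form equation on `{x⁰ ≥ 0}` outside the
horizons satisfies `∫_{‖y‖ ≤ R, ext} Σ(∂ψ)²(t, y) dy ≤ K ∫_{‖y‖ ≤ R + 2, ext} Σ(∂ψ)²(s, y) dy`
whenever `0 ≤ s ≤ t ≤ s + 1`. Mechanism: TIME TRANSLATION OF THE CONFIGURATION. With lab
velocities `vᵢ = u⃗ᵢ/uᵢ⁰`, the translated centres `p'ᵢ = pᵢ + s vᵢ` are still `40`-separated and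
strictly receding (`‖Δp + sΔv‖ ≥ ‖Δp‖`, `⟪Δp + sΔv, Δv⟫ = ⟪Δp, Δv⟫ + s‖Δv‖²`), the rest-frame maps
satisfy `qᵢ(x + s e₀) = q'ᵢ(x) + (s/uᵢ⁰) e₀` (Poincaré maps are affine, `Λᵢ⁻¹uᵢ = e₀`), so by
stationarity of `r`, `H`, `ℓ♯` along `e₀` in the rest frame the translated field
`G(· + s e₀)` IS the patched field of the translated configuration, the exteriors correspond, and
`ψ(· + s e₀)` solves the translated equation on `{x⁰ ≥ 0}` (Fréchet derivatives commute with
translations). The pointwise package `(Φ, D)` of `stub_cruxFieldPointwise` is TRANSPORTED (not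
re-derived), so the constant `18(1+Φ)² e^{192(1+Φ)D}` of `srfd_localEnergyZero` serves every `s`.
O'Neill 1983, Ch. 9 (Poincaré maps); Kerr–Schild 1965, §2 (stationarity); Hawking–Ellis 1973,
§4.3, Lemma 4.3.1. [folklore]
-/

noncomputable section

-- the doubled `FinalStateConjecture.FinalStateConjecture` path component trips dupNamespace
set_option linter.dupNamespace false

open scoped ContDiff Topology InnerProductSpace BigOperators ENNReal
open MeasureTheory Metric Set Filter Literature.Geometry.Lorentzian

namespace Summit.FinalStateConjecture.FinalStateConjecture.Theorems.ClusterCompleteness.TwoPins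

open Summit.FinalStateConjecture.FinalStateConjecture.Cruxes.AdiabaticMultiKerrILED.Sketch

/-! ### Time translation of the configuration -/

/-- **Rest-frame coordinates of a lab-time translate.** For `u = Λe₀` with `u⁰ ≠ 0` and the
lab-translated centre `p' = p + s·(u⃗/u⁰)`:
`Λ⁻¹((x + s e₀) − (0, p)) = Λ⁻¹(x − (0, p')) + (s/u⁰) e₀` — the world-line of the hole through
`(0, p)` with `4`-velocity `∝ u` passes through `(s, p + s u⃗/u⁰)`, and Poincaré maps are affine
(O'Neill 1983, Ch. 9, p. 236). [folklore] -/
private theorem srfd_poincareInv_shift (Λ : lorentzGroup) {u : E4}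
    (hu : u = (Λ : E4 ≃L[ℝ] E4) (E4.basisVector 0)) (h0 : u 0 ≠ 0) (p : E3) (s : ℝ) (x : E4) :
    poincareInv Λ (E4.ofTimeSpace 0 p) (x + s • E4.basisVector 0) =
      poincareInv Λ (E4.ofTimeSpace 0 (p + s • ((u 0)⁻¹ • E4.spatial u))) x +
        (s * (u 0)⁻¹) • E4.basisVector 0 := by
  have he : (Λ : E4 ≃L[ℝ] E4).symm u = E4.basisVector 0 := by
    rw [hu, ContinuousLinearEquiv.symm_apply_apply]
  have key : x + s • E4.basisVector 0 - E4.ofTimeSpace 0 p =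
      (x - E4.ofTimeSpace 0 (p + s • ((u 0)⁻¹ • E4.spatial u))) + (s * (u 0)⁻¹) • u := by
    ext μ
    refine Fin.cases ?_ (fun j ↦ ?_) μ
    · simp only [PiLp.sub_apply, PiLp.add_apply, PiLp.smul_apply, smul_eq_mul,
        E4.ofTimeSpace_apply_zero, PiLp.single_apply, if_true]
      rw [mul_assoc, inv_mul_cancel₀ h0]
      ring
    · simp only [PiLp.sub_apply, PiLp.add_apply, PiLp.smul_apply, smul_eq_mul,
        E4.ofTimeSpace_apply_succ, PiLp.single_apply, Fin.succ_ne_zero, if_false,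
        E4.spatial_apply]
      ring
  simp only [poincareInv]
  rw [key, map_add, map_smul, he]

/-- **The translated configuration is still separated and strictly receding**: for `s ≥ 0`,
`‖Δp + sΔv‖ ≥ ‖Δp‖` and `⟪Δp + sΔv, Δv⟫ = ⟪Δp, Δv⟫ + s‖Δv‖² > 0` when `⟪Δp, Δv⟫ > 0`
(elementary Euclidean geometry). [folklore] -/
private theorem srfd_sep_shift {pi pj vi vj : E3} {s d : ℝ} (hs : 0 ≤ s)
    (hd : d ≤ dist pi pj) (hin : 0 < ⟪pi - pj, vi - vj⟫_ℝ) :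
    d ≤ dist (pi + s • vi) (pj + s • vj) ∧ 0 < ⟪(pi + s • vi) - (pj + s • vj), vi - vj⟫_ℝ := by
  have hsplit : (pi + s • vi) - (pj + s • vj) = (pi - pj) + s • (vi - vj) := by
    rw [smul_sub]; abel
  constructor
  · rw [dist_eq_norm, hsplit]
    rw [dist_eq_norm] at hd
    have h1 : ‖pi - pj‖ ^ 2 ≤ ‖(pi - pj) + s • (vi - vj)‖ ^ 2 := by
      rw [norm_add_sq_real, real_inner_smul_right]
      nlinarith [hin, sq_nonneg ‖s • (vi - vj)‖, mul_nonneg hs hin.le]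
    exact hd.trans (le_of_pow_le_pow_left₀ two_ne_zero (norm_nonneg _) h1)
  · rw [hsplit, inner_add_left, real_inner_smul_left]
    have h2 : 0 ≤ ⟪vi - vj, vi - vj⟫_ℝ := real_inner_self_nonneg
    nlinarith [mul_nonneg hs h2]

/-! ### The uniform local energy propagation -/

/-- **Local energy propagation, uniform in the base time.** On the tails-cut patched multi-Kerr
background of a `40`-separated, strictly receding configuration (`|aᵢ| ≤ Mᵢ/2`, lab speeds `≤ 1/2`)
there is `K < ∞` such that every smooth `ψ` solving the divergence-form equation at the exterior
points with `x⁰ ≥ 0` satisfies, for `0 ≤ s ≤ t ≤ s + 1` and every `R`,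
`∫_{‖y‖ ≤ R, ext} Σ(∂ψ)²(t, y) dy ≤ K ∫_{‖y‖ ≤ R + 2, ext} Σ(∂ψ)²(s, y) dy`
(`srfd_localEnergyZero` for the configuration translated by `s`, with the transported pointwise
package; Hawking–Ellis 1973, §4.3, Lemma 4.3.1). [folklore] -/
theorem srfd_localEnergyShift :
    ∀ {N : ℕ} (M a : Fin N → ℝ) (Λ : Fin N → lorentzGroup) (p : Fin N → E3) (u : Fin N → E4)
      (q : Fin N → E4 → E4),
      (∀ i, u i = (Λ i : E4 ≃L[ℝ] E4) (E4.basisVector 0)) →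
      (∀ i x, q i x = poincareInv (Λ i) (E4.ofTimeSpace 0 (p i)) x) →
      (∀ i, 0 < M i) → (∀ i, |a i| ≤ 2⁻¹ * M i) →
      (∀ i, 0 < u i 0 ∧ ‖E4.spatial (u i)‖ ≤ 2⁻¹ * u i 0) →
      (∀ i j, i ≠ j → 40 * (M i + M j) ≤ dist (p i) (p j) ∧
        0 < ⟪p i - p j, (u i 0)⁻¹ • E4.spatial (u i) - (u j 0)⁻¹ • E4.spatial (u j)⟫_ℝ) →
      ∀ (G : E4 → Fin 4 → Fin 4 → ℝ),
      (∀ x μ ν, G x μ ν = Minkowski.bilin (E4.basisVector μ) (E4.basisVector ν) -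
        ∑ i, Real.smoothTransition (2 - Kerr.radius (a i) (q i x) / (8 * M i)) *
          (2 * Kerr.scalarH (M i) (a i) (q i x)) *
          ((Λ i : E4 ≃L[ℝ] E4) (Kerr.nullVector (a i) (q i x))) μ *
          ((Λ i : E4 ≃L[ℝ] E4) (Kerr.nullVector (a i) (q i x))) ν) →
      ∃ K : ℝ≥0∞, K ≠ ⊤ ∧ ∀ ψ : E4 → ℝ, ContDiff ℝ ∞ ψ →
        (∀ x : E4, 0 ≤ x 0 → (∀ i, Kerr.rPlus (M i) (a i) < Kerr.radius (a i) (q i x)) →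
          ∑ μ : Fin 4, fderiv ℝ (fun y ↦ ∑ ν : Fin 4, G y μ ν * fderiv ℝ ψ y (E4.basisVector ν)) x
            (E4.basisVector μ) = 0) →
        ∀ R s t : ℝ, 0 ≤ s → s ≤ t → t ≤ s + 1 →
          ∫⁻ y in {y : E3 | ‖y‖ ≤ R ∧ ∀ i, Kerr.rPlus (M i) (a i) <
              Kerr.radius (a i) (q i (E4.ofTimeSpace t y))},
            ENNReal.ofReal (∑ μ : Fin 4, (fderiv ℝ ψ (E4.ofTimeSpace t y) (E4.basisVector μ)) ^ 2) ≤
          K * ∫⁻ y in {y : E3 | ‖y‖ ≤ R + 2 ∧ ∀ i, Kerr.rPlus (M i) (a i) <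
              Kerr.radius (a i) (q i (E4.ofTimeSpace s y))},
            ENNReal.ofReal (∑ μ : Fin 4, (fderiv ℝ ψ (E4.ofTimeSpace s y) (E4.basisVector μ)) ^ 2) := by
  intro N M a Λ p u q hu hq hM ha hv hsep G hG
  obtain ⟨Φ, D, hΦ0, hD0, hKS, hDb, hlayer⟩ :=
    stub_cruxFieldPointwise M a Λ p u q hu hq hM ha hv hsep G hG
  refine ⟨ENNReal.ofReal (18 * (1 + Φ) ^ 2 * Real.exp (192 * (1 + Φ) * D)), ENNReal.ofReal_ne_top,
    fun ψ hψ hsol R s t hs hst hts ↦ ?_⟩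
  obtain ⟨T, rfl⟩ : ∃ T, t = T + s := ⟨t - s, by ring⟩
  have hT0 : 0 ≤ T := by linarith
  have hT1 : T ≤ 1 := by linarith
  -- ### the translated configuration, field and solution
  set p' : Fin N → E3 := fun i ↦ p i + s • ((u i 0)⁻¹ • E4.spatial (u i)) with hp'
  set q' : Fin N → E4 → E4 := fun i x ↦ poincareInv (Λ i) (E4.ofTimeSpace 0 (p' i)) x with hq'
  set G' : E4 → Fin 4 → Fin 4 → ℝ := fun x ↦ G (x + s • E4.basisVector 0) with hG'def
  set ψ' : E4 → ℝ := fun x ↦ ψ (x + s • E4.basisVector 0) with hψ'def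
  have hqs : ∀ i x, q i (x + s • E4.basisVector 0) = q' i x + (s * (u i 0)⁻¹) • E4.basisVector 0 := fun i x ↦ by
    rw [hq i]
    exact srfd_poincareInv_shift (Λ i) (hu i) (hv i).1.ne' (p i) s x
  have hrad : ∀ i x, Kerr.radius (a i) (q' i x) = Kerr.radius (a i) (q i (x + s • E4.basisVector 0)) :=
    fun i x ↦ by rw [hqs, Kerr.radius_add_time_smul_basisVector]
  have hx0s : ∀ x : E4, 0 ≤ x 0 → 0 ≤ (x + s • E4.basisVector 0) 0 := fun x hx ↦ by
    simp only [PiLp.add_apply, PiLp.smul_apply, smul_eq_mul, PiLp.single_apply,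
      if_true, mul_one]
    linarith
  have hext : ∀ x : E4, (∀ i, Kerr.rPlus (M i) (a i) < Kerr.radius (a i) (q' i x)) →
      ∀ i, Kerr.rPlus (M i) (a i) < Kerr.radius (a i) (q i (x + s • E4.basisVector 0)) :=
    fun x h i ↦ by rw [← hrad]; exact h i
  have hsep' : ∀ i j, i ≠ j → 40 * (M i + M j) ≤ dist (p' i) (p' j) ∧
      0 < ⟪p' i - p' j, (u i 0)⁻¹ • E4.spatial (u i) - (u j 0)⁻¹ • E4.spatial (u j)⟫_ℝ :=
    fun i j hij ↦ srfd_sep_shift hs (hsep i j hij).1 (hsep i j hij).2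
  have hG' : ∀ x μ ν, G' x μ ν = Minkowski.bilin (E4.basisVector μ) (E4.basisVector ν) -
      ∑ i, Real.smoothTransition (2 - Kerr.radius (a i) (q' i x) / (8 * M i)) *
        (2 * Kerr.scalarH (M i) (a i) (q' i x)) *
        ((Λ i : E4 ≃L[ℝ] E4) (Kerr.nullVector (a i) (q' i x))) μ *
        ((Λ i : E4 ≃L[ℝ] E4) (Kerr.nullVector (a i) (q' i x))) ν := by
    intro x μ ν
    simp only [hG'def, hG, hqs, Kerr.radius_add_time_smul_basisVector,
      Kerr.scalarH_add_smul_basisVector_zero, Kerr.nullVector_add_smul_basisVector_zero]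
  -- ### transport of the pointwise package
  have hKS' : ∀ x : E4, 0 ≤ x 0 → (∀ i, Kerr.rPlus (M i) (a i) < Kerr.radius (a i) (q' i x)) →
      ∃ (φ₀ : ℝ) (l₀ : E4), 0 ≤ φ₀ ∧ φ₀ ≤ Φ ∧
        Minkowski.bilin l₀ l₀ = 0 ∧ Minkowski.bilin l₀ (E4.basisVector 0) = 1 ∧
        ∀ μ ν, G' x μ ν = Kerr.etaComp μ ν - φ₀ * l₀ μ * l₀ ν :=
    fun x hx0 h ↦ hKS (x + s • E4.basisVector 0) (hx0s x hx0) (hext x h)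
  have hDb' : ∀ x : E4, (∀ i, Kerr.rPlus (M i) (a i) < Kerr.radius (a i) (q' i x)) →
      ∀ μ α β : Fin 4, |fderiv ℝ (fun y ↦ G' y α β) x (E4.basisVector μ)| ≤ D := by
    intro x h μ α β
    have hcomp : fderiv ℝ (fun y ↦ G' y α β) x =
        fderiv ℝ (fun z ↦ G z α β) (x + s • E4.basisVector 0) :=
      fderiv_comp_add_right (f := fun z ↦ G z α β) (s • E4.basisVector 0)
    rw [hcomp]
    exact hDb (x + s • E4.basisVector 0) (hext x h) μ α β
  have hlayer' : ∀ x : E4, 0 ≤ x 0 → ∀ i, Kerr.radius (a i) (q' i x) ≤ 8 * M i →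
      ∀ μ ν, G' x μ ν = Minkowski.bilin (E4.basisVector μ) (E4.basisVector ν) -
        2 * Kerr.scalarH (M i) (a i) (q' i x) *
          ((Λ i : E4 ≃L[ℝ] E4) (Kerr.nullVector (a i) (q' i x))) μ *
          ((Λ i : E4 ≃L[ℝ] E4) (Kerr.nullVector (a i) (q' i x))) ν := by
    intro x hx0 i h8 μ ν
    have h := hlayer (x + s • E4.basisVector 0) (hx0s x hx0) i (by rw [← hrad]; exact h8) μ ν
    rw [hqs i x, Kerr.scalarH_add_smul_basisVector_zero,
      Kerr.nullVector_add_smul_basisVector_zero] at h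
    exact h
  -- ### the translated solution
  have hψ' : ContDiff ℝ ∞ ψ' := hψ.comp (contDiff_id.add contDiff_const)
  have hsol' : ∀ x : E4, 0 ≤ x 0 → (∀ i, Kerr.rPlus (M i) (a i) < Kerr.radius (a i) (q' i x)) →
      ∑ μ : Fin 4, fderiv ℝ (fun y ↦ ∑ ν : Fin 4, G' y μ ν * fderiv ℝ ψ' y (E4.basisVector ν)) x
        (E4.basisVector μ) = 0 := by
    intro x hx0 h
    have hψs : ∀ y : E4, fderiv ℝ ψ' y = fderiv ℝ ψ (y + s • E4.basisVector 0) := fun y ↦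
      fderiv_comp_add_right (f := ψ) (s • E4.basisVector 0)
    have hfun : ∀ μ : Fin 4, (fun y ↦ ∑ ν : Fin 4, G' y μ ν * fderiv ℝ ψ' y (E4.basisVector ν)) =
        fun y ↦ (fun z ↦ ∑ ν : Fin 4, G z μ ν * fderiv ℝ ψ z (E4.basisVector ν))
          (y + s • E4.basisVector 0) := by
      intro μ
      funext y
      simp only [hG'def, hψs]
    calc ∑ μ : Fin 4, fderiv ℝ (fun y ↦ ∑ ν : Fin 4, G' y μ ν * fderiv ℝ ψ' y (E4.basisVector ν)) x
          (E4.basisVector μ)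
        = ∑ μ : Fin 4, fderiv ℝ (fun z ↦ ∑ ν : Fin 4, G z μ ν * fderiv ℝ ψ z (E4.basisVector ν))
            (x + s • E4.basisVector 0) (E4.basisVector μ) :=
          Finset.sum_congr rfl fun μ _ ↦ by
            rw [hfun μ, fderiv_comp_add_right
              (f := fun z ↦ ∑ ν : Fin 4, G z μ ν * fderiv ℝ ψ z (E4.basisVector ν))
              (s • E4.basisVector 0)]
      _ = 0 := hsol (x + s • E4.basisVector 0) (hx0s x hx0) (hext x h)
  -- ### the base-time-`0` estimate for the translated data, read back
  have h2a := srfd_localEnergyZero M a Λ p' u q' hu (fun i x ↦ rfl) hM ha hv hsep' G' hG' Φ D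
    hΦ0 hD0 hKS' hDb' hlayer' ψ' hψ' hsol' R T hT0 hT1
  have hderiv : ∀ (τ : ℝ) (y : E3) (μ : Fin 4), fderiv ℝ ψ' (E4.ofTimeSpace τ y) (E4.basisVector μ) =
      fderiv ℝ ψ (E4.ofTimeSpace (τ + s) y) (E4.basisVector μ) := by
    intro τ y μ
    rw [show fderiv ℝ ψ' (E4.ofTimeSpace τ y) =
        fderiv ℝ ψ (E4.ofTimeSpace τ y + s • E4.basisVector 0) from
      fderiv_comp_add_right (f := ψ) (s • E4.basisVector 0),
      Kerr.ofTimeSpace_add_smul_basisVector_zero]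
  have hradτ : ∀ (τ : ℝ) (y : E3) (i : Fin N), Kerr.radius (a i) (q' i (E4.ofTimeSpace τ y)) =
      Kerr.radius (a i) (q i (E4.ofTimeSpace (τ + s) y)) := by
    intro τ y i
    rw [hrad, Kerr.ofTimeSpace_add_smul_basisVector_zero]
  simp only [hderiv, hradτ, zero_add] at h2a
  exact h2a

end Summit.FinalStateConjecture.FinalStateConjecture.Theorems.ClusterCompleteness.TwoPins

end
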